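import Summits.CriticalPhenomena.PercolationContinuityZ3.Theorems.PercNearOneGluingNoHeavyLowerTailSahiOneStepFibreParam
import Mathlib.Combinatorics.Enumerative.DoubleCounting
import HarnessLib

/-!
# One-step scheme: LAYER MONOTONICITY of a product measure (the conditional law on `{#(F∩ω) = k}` increases with `k`)

Support file (prover prim-ineq-prove-3 gen 18; `--supports stmt-CriticalPhenomena-4575`; memo
`run/shared/lean/prim/prim-ineq-prove-3/FINDING-G18-TREE-LUMP.md` §5).  No definitions, no named facts, no sorries, no `native_decide`.

* Combinatorial core (local LYM by double counting): for a family `𝒰 ⊆ 2^D` closed upwards inside `2^D`, the layer densities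
  `#𝒰_r / C(|D|,r)` are nondecreasing in `r` (`card_layer_mul_choose_le`), hence a layer at or above the middle is at least as large as its mirror
  layer below the middle (`card_layer_mirror_le`).
* Measure level (two-copy fibre expansion of `…SahiOneStepFibre/FibreParam`): for a product measure, a block `F ⊆ G`, an increasing event `B`
  determined by `G` and `j ≤ k`:  `μ(B ∩ {N_F = j})·μ{N_F = k} ≤ μ(B ∩ {N_F = k})·μ{N_F = j}` (`real_inter_layer_mul_le`), i.e. the conditional
  laws `μ(· | N_F = k)` are stochastically increasing in `k` on increasing events — the ingredient of the two-singleton case of `(2′)`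
  (log-concavity flavour) and of the principal-`A` case (memo §5).
-/

noncomputable section

namespace Summit.CriticalPhenomena.PercolationContinuityZ3.Theorems

namespace SahiOneStep

open MeasureTheory Finset
open Literature.Probability.Percolation (DeterminedBy determinedBy_iff)
open Literature.Probability.LatticeModels (prodBernoulli)
open Literature.Probability.Percolation.DecisionTree (ind wtW ind_of_mem ind_of_not_mem)
open Literature.Probability.Percolation.BHK2006 (ind_inter)
open scoped Classical

variable {ι : Type*} [Fintype ι] [DecidableEq ι]

/-! ## Local LYM inside `2^D` by double counting -/

omit [Fintype ι] in
/-- **Local LYM (upward, multiplicative form).**  If `𝒰 ⊆ 2^D` is closed upwards inside `2^D` then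
`#𝒰_r · (|D| − r) ≤ #𝒰_{r+1} · (r+1)` (count the pairs `S ⊂ T`, `S ∈ 𝒰_r`, `T ∈ 𝒰_{r+1}`). [folklore] -/
theorem card_layer_succ_double_count (D : Finset ι) (𝒰 : Finset (Finset ι)) (h𝒰 : 𝒰 ⊆ D.powerset)
    (hup : ∀ S ∈ 𝒰, ∀ T ∈ D.powerset, S ⊆ T → T ∈ 𝒰) (r : ℕ) :
    #(𝒰.filter fun S => S.card = r) * (D.card - r) ≤ #(𝒰.filter fun S => S.card = r + 1) * (r + 1) := by
  refine Finset.card_mul_le_card_mul (fun S T => S ⊆ T) (fun S hS => ?_) (fun T hT => ?_)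
  · -- at least `|D| - r` supersets `insert x S`, `x ∈ D ∖ S`
    rw [Finset.mem_filter] at hS
    have hSD : S ⊆ D := Finset.mem_powerset.1 (h𝒰 hS.1)
    have hcard : (D \ S).card = D.card - r := by rw [Finset.card_sdiff_of_subset hSD, hS.2]
    rw [← hcard]
    refine Finset.card_le_card_of_injOn (fun x => insert x S) (fun x hx => ?_) (fun x hx x' hx' h => ?_)
    · rw [Finset.mem_coe, Finset.mem_sdiff] at hx
      rw [Finset.mem_coe, Finset.mem_bipartiteAbove, Finset.mem_filter]
      refine ⟨⟨hup S hS.1 _ (Finset.mem_powerset.2 (Finset.insert_subset hx.1 hSD)) (Finset.subset_insert _ _), ?_⟩,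
        Finset.subset_insert _ _⟩
      rw [Finset.card_insert_of_notMem hx.2, hS.2]
    · rw [Finset.mem_coe, Finset.mem_sdiff] at hx hx'
      have h' : insert x S = insert x' S := h
      have : x ∈ insert x' S := by rw [← h']; exact Finset.mem_insert_self _ _
      rcases Finset.mem_insert.1 this with h' | h'
      · exact h'
      · exact absurd h' hx.2
  · -- at most `r + 1` subsets of size `r`
    rw [Finset.mem_filter] at hT
    calc #(Finset.bipartiteBelow (fun S T => S ⊆ T) (𝒰.filter fun S => S.card = r) T)
        ≤ #(T.powersetCard r) := by
          refine Finset.card_le_card fun S hS => ?_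
          rw [Finset.mem_bipartiteBelow, Finset.mem_filter] at hS
          exact Finset.mem_powersetCard.2 ⟨hS.2, hS.1.2⟩
      _ = r + 1 := by rw [Finset.card_powersetCard, hT.2, Nat.choose_succ_self_right]

omit [Fintype ι] in
/-- **Layer densities of an up-closed family increase**: `#𝒰_r · C(|D|,s) ≤ #𝒰_s · C(|D|,r)` for `r ≤ s ≤ |D|`. [folklore] -/
theorem card_layer_mul_choose_le (D : Finset ι) (𝒰 : Finset (Finset ι)) (h𝒰 : 𝒰 ⊆ D.powerset)
    (hup : ∀ S ∈ 𝒰, ∀ T ∈ D.powerset, S ⊆ T → T ∈ 𝒰) {r s : ℕ} (hrs : r ≤ s) (hs : s ≤ D.card) :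
    #(𝒰.filter fun S => S.card = r) * (D.card).choose s ≤ #(𝒰.filter fun S => S.card = s) * (D.card).choose r := by
  obtain ⟨d, rfl⟩ := Nat.exists_eq_add_of_le hrs
  induction d with
  | zero => simp
  | succ d ih =>
    have hrd : r + d ≤ D.card := by omega
    have h1 := ih (Nat.le_add_right r d) hrd
    have h2 := card_layer_succ_double_count D 𝒰 h𝒰 hup (r + d)
    -- `C(n, r+d+1)·(r+d+1) = C(n, r+d)·(n − (r+d))`
    have hch : (D.card).choose (r + d + 1) * (r + d + 1) = (D.card).choose (r + d) * (D.card - (r + d)) := Nat.choose_succ_right_eq _ _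
    -- chain the two inequalities without division (multiply the goal by `r+d+1 > 0`)
    have hs : r + (d + 1) = r + d + 1 := rfl
    rw [hs]
    have key : #(𝒰.filter fun S => S.card = r) * (D.card).choose (r + d + 1) * (r + d + 1) ≤
        #(𝒰.filter fun S => S.card = r + d + 1) * (D.card).choose r * (r + d + 1) := by
      calc #(𝒰.filter fun S => S.card = r) * (D.card).choose (r + d + 1) * (r + d + 1)
          = #(𝒰.filter fun S => S.card = r) * ((D.card).choose (r + d + 1) * (r + d + 1)) := by ring
        _ = #(𝒰.filter fun S => S.card = r) * ((D.card).choose (r + d) * (D.card - (r + d))) := by rw [hch]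
        _ = #(𝒰.filter fun S => S.card = r) * (D.card).choose (r + d) * (D.card - (r + d)) := by ring
        _ ≤ #(𝒰.filter fun S => S.card = r + d) * (D.card).choose r * (D.card - (r + d)) := Nat.mul_le_mul_right _ h1
        _ = (D.card).choose r * (#(𝒰.filter fun S => S.card = r + d) * (D.card - (r + d))) := by ring
        _ ≤ (D.card).choose r * (#(𝒰.filter fun S => S.card = r + d + 1) * (r + d + 1)) := Nat.mul_le_mul_left _ h2
        _ = #(𝒰.filter fun S => S.card = r + d + 1) * (D.card).choose r * (r + d + 1) := by ring
    exact Nat.le_of_mul_le_mul_right key (Nat.succ_pos _)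

omit [Fintype ι] in
/-- **Mirror layers**: for `𝒰` up-closed in `2^D` and `|D| − a ≤ a ≤ |D|`, the layer `a` (at or above the middle) is at least as large as its
mirror layer `|D| − a`. [folklore] -/
theorem card_layer_mirror_le (D : Finset ι) (𝒰 : Finset (Finset ι)) (h𝒰 : 𝒰 ⊆ D.powerset)
    (hup : ∀ S ∈ 𝒰, ∀ T ∈ D.powerset, S ⊆ T → T ∈ 𝒰) {a : ℕ} (ha : D.card - a ≤ a) (haD : a ≤ D.card) :
    #(𝒰.filter fun S => S.card = D.card - a) ≤ #(𝒰.filter fun S => S.card = a) := by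
  have h := card_layer_mul_choose_le D 𝒰 h𝒰 hup ha haD
  rw [Nat.choose_symm haD] at h
  exact Nat.le_of_mul_le_mul_right h (Nat.choose_pos haD)

/-! ## A generic two-copy comparison of products of probabilities -/

omit [Fintype ι] in
/-- **Two-copy expansion of a difference of products.**  For `F`-determined events,
`μX·μY − μX′·μY′ = Σ_{(S,S′)} wtW(S)·wtW(S′)·(1_X(S)1_Y(S′) − 1_{X′}(S)1_{Y′}(S′))`. [folklore] -/
theorem real_mul_real_sub_eq_sum_pairs (p : ι → unitInterval) {F : Finset ι} {X Y X' Y' : Set (Set ι)}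
    (hX : DeterminedBy X (↑F : Set ι)) (hY : DeterminedBy Y (↑F : Set ι)) (hX' : DeterminedBy X' (↑F : Set ι))
    (hY' : DeterminedBy Y' (↑F : Set ι)) :
    (prodBernoulli p).real X * (prodBernoulli p).real Y - (prodBernoulli p).real X' * (prodBernoulli p).real Y' =
      ∑ x ∈ F.powerset ×ˢ F.powerset, wtW F (fun i => (p i : ℝ)) x.1 * wtW F (fun i => (p i : ℝ)) x.2 *
        (ind (pat X) x.1 * ind (pat Y) x.2 - ind (pat X') x.1 * ind (pat Y') x.2) := by
  rw [real_eq_sum_wtW_ind p hX, real_eq_sum_wtW_ind p hY, real_eq_sum_wtW_ind p hX', real_eq_sum_wtW_ind p hY',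
    Finset.sum_mul_sum, Finset.sum_mul_sum, ← Finset.sum_product', ← Finset.sum_product', ← Finset.sum_sub_distrib]
  exact Finset.sum_congr rfl fun x _ => by ring

omit [Fintype ι] in
/-- **Two-copy fibre criterion for `μX′·μY′ ≤ μX·μY`.**  If on every fibre `I ⊆ J ⊆ F` the antipodal count of `(X′, Y′)` is at most that of
`(X, Y)` — `Σ_{R ⊆ J∖I} 1_{X′}(I∪R)1_{Y′}(J∖R) ≤ Σ_{R ⊆ J∖I} 1_X(I∪R)1_Y(J∖R)` — then `μX′·μY′ ≤ μX·μY`. [this work] -/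
theorem real_mul_real_le_of_fibre2 (p : ι → unitInterval) {F : Finset ι} {X Y X' Y' : Set (Set ι)}
    (hX : DeterminedBy X (↑F : Set ι)) (hY : DeterminedBy Y (↑F : Set ι)) (hX' : DeterminedBy X' (↑F : Set ι))
    (hY' : DeterminedBy Y' (↑F : Set ι))
    (hfib : ∀ I J : Finset ι, I ⊆ J → J ⊆ F →
      ∑ R ∈ (J \ I).powerset, ind (pat X') (I ∪ R) * ind (pat Y') (J \ R) ≤
        ∑ R ∈ (J \ I).powerset, ind (pat X) (I ∪ R) * ind (pat Y) (J \ R)) :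
    (prodBernoulli p).real X' * (prodBernoulli p).real Y' ≤ (prodBernoulli p).real X * (prodBernoulli p).real Y := by
  rw [← sub_nonneg, real_mul_real_sub_eq_sum_pairs p hX hY hX' hY']
  set pr : ι → ℝ := fun i => (p i : ℝ) with hpr
  have hp0 : ∀ i, 0 ≤ pr i := fun i => (p i).2.1
  have hp1 : ∀ i, pr i ≤ 1 := fun i => (p i).2.2
  rw [← Finset.sum_fiberwise_of_maps_to (g := fun x : Finset ι × Finset ι => (x.1 ∩ x.2, x.1 ∪ x.2))
    (t := F.powerset ×ˢ F.powerset) (fun x hx => by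
      simp only [Finset.mem_product, Finset.mem_powerset] at hx ⊢
      exact ⟨Finset.inter_subset_left.trans hx.1, Finset.union_subset hx.1 hx.2⟩)]
  refine Finset.sum_nonneg fun IJ _ => ?_
  have hc : ∀ x ∈ (F.powerset ×ˢ F.powerset).filter (fun x => (x.1 ∩ x.2, x.1 ∪ x.2) = IJ),
      wtW F pr x.1 * wtW F pr x.2 * (ind (pat X) x.1 * ind (pat Y) x.2 - ind (pat X') x.1 * ind (pat Y') x.2) =
        wfib F pr IJ.1 IJ.2 * (ind (pat X) x.1 * ind (pat Y) x.2 - ind (pat X') x.1 * ind (pat Y') x.2) := by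
    intro x hx
    rw [Finset.mem_filter] at hx
    rw [wtW_mul_wtW_eq, ← hx.2]
  rw [Finset.sum_congr rfl hc, ← Finset.mul_sum]
  refine mul_nonneg (wfib_nonneg F hp0 hp1 _ _) ?_
  obtain ⟨I, J⟩ := IJ
  by_cases h : I ⊆ J ∧ J ⊆ F
  · rw [fibre2_sum_eq F h.1 h.2 (fun S S' => ind (pat X) S * ind (pat Y) S' - ind (pat X') S * ind (pat Y') S'),
      Finset.sum_sub_distrib, sub_nonneg]
    exact hfib I J h.1 h.2
  · rw [fibre2_filter_eq_empty F h, Finset.sum_empty]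

/-! ## Layer monotonicity -/

omit [Fintype ι] [DecidableEq ι] in
/-- The layer event `{#(F ∩ ω) = k}` is determined by `F`. [folklore] -/
theorem determinedBy_layer (F : Finset ι) (k : ℕ) : DeterminedBy {ω : Set ι | (F.filter (· ∈ ω)).card = k} (↑F : Set ι) := by
  rw [determinedBy_iff]
  intro ω ω' h
  simp only [Set.mem_setOf_eq]
  have hf : F.filter (· ∈ ω) = F.filter (· ∈ ω') := by
    ext i
    simp only [Finset.mem_filter, and_congr_right_iff]
    intro hi
    have h1 := Set.ext_iff.1 h i
    simp only [Set.mem_inter_iff, Finset.mem_coe] at h1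
    exact ⟨fun hω => (h1.1 ⟨hω, hi⟩).1, fun hω' => (h1.2 ⟨hω', hi⟩).1⟩
  rw [hf]

omit [Fintype ι] in
/-- On an `F`-pattern `T ⊆ F` the layer indicator reads `#T`. [folklore] -/
theorem ind_pat_layer (F : Finset ι) (k : ℕ) {T : Finset ι} (hT : T ⊆ F) :
    ind (pat {ω : Set ι | (F.filter (· ∈ ω)).card = k}) T = if T.card = k then 1 else 0 := by
  by_cases h : T.card = k
  · rw [if_pos h]
    apply ind_of_mem
    rw [mem_pat, Set.mem_setOf_eq]
    convert h using 2
    ext i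
    simp only [Finset.mem_filter, Finset.mem_coe]
    exact ⟨fun h => h.2, fun h => ⟨hT h, h⟩⟩
  · rw [if_neg h]
    apply ind_of_not_mem
    rw [mem_pat, Set.mem_setOf_eq]
    intro h'
    apply h
    convert h' using 2
    ext i
    simp only [Finset.mem_filter, Finset.mem_coe]
    exact ⟨fun h => ⟨hT h, h⟩, fun h => h.2⟩

omit [Fintype ι] in
/-- On an `F`-pattern, the indicator of `B ∩ layer` factors. [folklore] -/
theorem ind_pat_inter_layer (F : Finset ι) (B : Set (Set ι)) (k : ℕ) {T : Finset ι} (hT : T ⊆ F) :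
    ind (pat (B ∩ {ω : Set ι | (F.filter (· ∈ ω)).card = k})) T = ind (pat B) T * (if T.card = k then 1 else 0) := by
  rw [← ind_pat_layer F k hT, pat_inter, ind_inter]

omit [Fintype ι] in
/-- **LAYER MONOTONICITY.**  For a product measure, a block `F`, an increasing event `B` determined by `F` and `j ≤ k`:
`μ(B ∩ {N_F = j})·μ{N_F = k} ≤ μ(B ∩ {N_F = k})·μ{N_F = j}` (`N_F(ω) = #(F ∩ ω)`): the conditional laws of the layers are stochastically
increasing.  Fibrewise this is the mirror-layer inequality `card_layer_mirror_le`. [folklore; this proof] -/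
theorem real_inter_layer_mul_le (p : ι → unitInterval) (F : Finset ι) {B : Set (Set ι)} (hB : IsUpperSet B)
    (hBF : DeterminedBy B (↑F : Set ι)) {j k : ℕ} (hjk : j ≤ k) :
    (prodBernoulli p).real (B ∩ {ω : Set ι | (F.filter (· ∈ ω)).card = j}) * (prodBernoulli p).real {ω : Set ι | (F.filter (· ∈ ω)).card = k} ≤
      (prodBernoulli p).real (B ∩ {ω : Set ι | (F.filter (· ∈ ω)).card = k}) * (prodBernoulli p).real {ω : Set ι | (F.filter (· ∈ ω)).card = j} := by
  refine real_mul_real_le_of_fibre2 p (hBF.inter (determinedBy_layer F k)) (determinedBy_layer F j)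
    (hBF.inter (determinedBy_layer F j)) (determinedBy_layer F k) fun I J hIJ hJF => ?_
  -- on the fibre `(I,J)`: `R ⊆ D = J ∖ I`, patterns `I ∪ R` (size `#I + #R`) and `J ∖ R` (size `#J − #R`)
  set D := J \ I with hD
  have hID : Disjoint I D := Finset.disjoint_sdiff
  have hIF : I ⊆ F := hIJ.trans hJF
  have memD : ∀ R ∈ D.powerset, R ⊆ D := fun R hR => Finset.mem_powerset.1 hR
  have cardIR : ∀ R ∈ D.powerset, (I ∪ R).card = I.card + R.card := fun R hR =>
    Finset.card_union_of_disjoint (hID.mono_right (memD R hR))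
  have cardJR : ∀ R ∈ D.powerset, (J \ R).card = J.card - R.card := fun R hR =>
    Finset.card_sdiff_of_subset ((memD R hR).trans Finset.sdiff_subset)
  have hRJ : ∀ R ∈ D.powerset, R.card ≤ J.card := fun R hR =>
    Finset.card_le_card ((memD R hR).trans Finset.sdiff_subset)
  have subIR : ∀ R ∈ D.powerset, I ∪ R ⊆ F := fun R hR =>
    Finset.union_subset hIF (((memD R hR).trans Finset.sdiff_subset).trans hJF)
  have subJR : ∀ R ∈ D.powerset, J \ R ⊆ F := fun R _ => Finset.sdiff_subset.trans hJF
  have hJcard : J.card = I.card + D.card := by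
    have := Finset.card_le_card hIJ
    rw [hD, Finset.card_sdiff_of_subset hIJ]; omega
  -- rewrite both sums as counts of `R` by cardinality
  have lhs_eq : ∀ R ∈ D.powerset,
      ind (pat (B ∩ {ω : Set ι | (F.filter (· ∈ ω)).card = j})) (I ∪ R) * ind (pat {ω : Set ι | (F.filter (· ∈ ω)).card = k}) (J \ R) =
        ind (pat B) (I ∪ R) * (if I.card + R.card = j ∧ J.card - R.card = k then 1 else 0) := by
    intro R hR
    rw [ind_pat_inter_layer F B j (subIR R hR), ind_pat_layer F k (subJR R hR), cardIR R hR, cardJR R hR]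
    by_cases h1 : I.card + R.card = j <;> by_cases h2 : J.card - R.card = k <;> simp [h1, h2]
  have rhs_eq : ∀ R ∈ D.powerset,
      ind (pat (B ∩ {ω : Set ι | (F.filter (· ∈ ω)).card = k})) (I ∪ R) * ind (pat {ω : Set ι | (F.filter (· ∈ ω)).card = j}) (J \ R) =
        ind (pat B) (I ∪ R) * (if I.card + R.card = k ∧ J.card - R.card = j then 1 else 0) := by
    intro R hR
    rw [ind_pat_inter_layer F B k (subIR R hR), ind_pat_layer F j (subJR R hR), cardIR R hR, cardJR R hR]
    by_cases h1 : I.card + R.card = k <;> by_cases h2 : J.card - R.card = j <;> simp [h1, h2]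
  rw [Finset.sum_congr rfl lhs_eq, Finset.sum_congr rfl rhs_eq]
  -- the up-closed family `𝒰 = {R ⊆ D : ↑(I ∪ R) ∈ B}`
  set 𝒰 := D.powerset.filter (fun R => ((↑(I ∪ R) : Set ι)) ∈ B) with h𝒰
  have h𝒰D : 𝒰 ⊆ D.powerset := Finset.filter_subset _ _
  have h𝒰up : ∀ S ∈ 𝒰, ∀ T ∈ D.powerset, S ⊆ T → T ∈ 𝒰 := by
    intro S hS T hT hST
    rw [h𝒰, Finset.mem_filter] at hS ⊢
    refine ⟨hT, hB ?_ hS.2⟩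
    exact Finset.coe_subset.2 (Finset.union_subset_union (subset_refl I) hST)
  -- both sums are layer counts of `𝒰`
  have count : ∀ P : ℕ → Prop, ∀ [DecidablePred P],
      ∑ R ∈ D.powerset, ind (pat B) (I ∪ R) * (if P R.card then (1 : ℝ) else 0) = #(𝒰.filter fun R => P R.card) := by
    intro P _
    rw [Finset.card_eq_sum_ones, Finset.sum_filter, Finset.sum_filter, Nat.cast_sum]
    refine Finset.sum_congr rfl fun R hR => ?_
    by_cases hRB : ((↑(I ∪ R) : Set ι)) ∈ B
    · rw [ind_of_mem (mem_pat.2 hRB), one_mul, if_pos hRB]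
      by_cases hP : P R.card <;> simp [hP]
    · rw [ind_of_not_mem (fun h => hRB (mem_pat.1 h)), zero_mul, if_neg hRB, Nat.cast_zero]
  rw [count (fun r => I.card + r = j ∧ J.card - r = k), count (fun r => I.card + r = k ∧ J.card - r = j)]
  -- degenerate fibres: the conditions force `#D = (k − #I) + (j − #I)`
  by_cases hP : I.card ≤ j ∧ (k - I.card) + (j - I.card) = D.card
  · obtain ⟨hcj, hsum⟩ := hP
    have hck : I.card ≤ k := hcj.trans hjk
    have e1 : (𝒰.filter fun R => I.card + R.card = j ∧ J.card - R.card = k) = 𝒰.filter fun R => R.card = D.card - (k - I.card) := by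
      refine Finset.filter_congr fun R hR => ?_
      have hRD := Finset.card_le_card (Finset.mem_powerset.1 (h𝒰D hR))
      constructor
      · rintro ⟨h1, _⟩; omega
      · intro h; constructor <;> omega
    have e2 : (𝒰.filter fun R => I.card + R.card = k ∧ J.card - R.card = j) = 𝒰.filter fun R => R.card = k - I.card := by
      refine Finset.filter_congr fun R hR => ?_
      have hRD := Finset.card_le_card (Finset.mem_powerset.1 (h𝒰D hR))
      constructor
      · rintro ⟨h1, _⟩; omega
      · intro h; constructor <;> omega
    rw [e1, e2]
    exact_mod_cast card_layer_mirror_le D 𝒰 h𝒰D h𝒰up (a := k - I.card) (by omega) (by omega)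
  · -- both families are empty
    have e1 : (𝒰.filter fun R => I.card + R.card = j ∧ J.card - R.card = k) = ∅ := by
      rw [Finset.filter_eq_empty_iff]
      intro R hR ⟨h1, h2⟩
      have hRD := Finset.card_le_card (Finset.mem_powerset.1 (h𝒰D hR))
      apply hP; constructor <;> omega
    have e2 : (𝒰.filter fun R => I.card + R.card = k ∧ J.card - R.card = j) = ∅ := by
      rw [Finset.filter_eq_empty_iff]
      intro R hR ⟨h1, h2⟩
      have hRD := Finset.card_le_card (Finset.mem_powerset.1 (h𝒰D hR))
      apply hP; constructor <;> omega
    rw [e1, e2]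

end SahiOneStep

end Summit.CriticalPhenomena.PercolationContinuityZ3.Theorems
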